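import Summits.Ventures.CertifiedQuantumChemistry.Rows.GroundStateOverlapRows
import Summits.Ventures.CertifiedQuantumChemistry.Rows.SingletGapCertificateCodimOne
import Summits.Ventures.CertifiedQuantumChemistry.Rows.SingletUpperSpinBound
import HarnessLib

/-!
# Rows/SingletGroundStateOverlapRows.lean: certified ground-state OVERLAP rows on the SINGLET sector —
# Eckart's criterion restricted to `K = (n, n)-sector ∩ ker Ŝ_+`

HONEST FRAMING (verbatim): certified bounds for a stated model Hamiltonian in a stated basis; not a claim about
the real molecule or material beyond that model.

LADDER-CHEM I-TYPE (cell chem-oracle, seat chem-type-06 gen 6, offer (J′); slot-06 lane = Rayleigh–Ritz in a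
sector + exact records). The SINGLET twin of `Rows/GroundStateOverlapRows` (p484644). Why a twin is needed: the
only certifiable gap legs for an antiferromagnetically coupled open-shell file (door M1-OS; cell files HC / HFe2
:XS (8,8)) live on the singlet subspace `K = singletSector k n` (`Statement.lean`) — on the plain `(n, n)`
sector the second level is the `M_S = 0` component of the lowest triplet, a fraction of a millihartree above
`E₀`, so no sector gap leg exists at any rung, and every row of the (J) file (stated with
`GapCertificateCodimOne F a b σ` on the sector) is inapplicable verbatim. This file restates NOTHING of the
tree's inequality (`TempleKato.sin_sq_mul_gap_le`, `TempleKato.gap_of_codimOne_certificate`,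
`TempleKato.eq_smul_of_eigen`, all generic in the subspace `K`); it is their ROW-LEVEL reading on `K`:
* `Model.IsSingletGroundState F n ψ` — `ψ ∈ singletSector k n`, `ψ ≠ 0`, `Re⟨ψ, Ĥψ⟩ = E₀^{S=0}·⟨ψ, ψ⟩`
  (mirror of `Model.IsGroundState`; an eigenvector by Rayleigh–Ritz equality on the `Ĥ(F)`-invariant `K`);
* `SingletOverlapLowerRow F n φ w` — for EVERY singlet ground state `ψ`: `w·⟨φ,φ⟩⟨ψ,ψ⟩ ≤ |⟨φ,ψ⟩|²`;
* SOUNDNESS (`singletOverlapLowerRow_of_singletGapCertificateCodimOne`): chem-type-09's codimension-one gap leg ON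
  `K`, `SingletGapCertificateCodimOne F n σ` (`Rows/SingletGapCertificateCodimOne`, p490432 — «`λ₂(Ĥ_F|K) ≥ σ`»,
  produced there from a level-shift / sub-Hamiltonian deflator leg, HYPOTHESES-M1OS (G); imported, no gap OBJECT
  is defined here), a reference vector `φ ∈ K`, `φ ≠ 0`, `Re⟨φ, Ĥφ⟩ ≤ ρ‖φ‖²`, a lower bound `ℓ ≤ E₀^{S=0}` (any
  sector `LowerRow F n n ℓ` or `SingletLowerRow F n ℓ`), `ρ < σ`, `w(σ − ℓ) ≤ σ − ρ`; PRODUCER-AGNOSTIC corollary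
  `singletOverlapLowerRow_of_forall_orthogonal` from the bare form bound «`∀ x ∈ K, ⟨v, x⟩ = 0 → σ‖x‖² ≤
  Re⟨x, Ĥ(F)x⟩`» ((G) literally);
* CERTIFIED SIMPLICITY of the singlet ground level (`singletGroundState_eq_smul_of_energy_lt_gap`,
  `…_of_singletUpperRow_lt`, `…_of_rayleigh_lt`);
* THE `S_z`-TRIAL READING (a sector record that is NOT exactly a singlet, with a certified `‖Ŝ_+φ‖² ≤ s`) is the
  sibling file `Rows/SingletOverlapSpinContaminatedTrial.lean`.
Printed source of the inequality: Goodisman (1973) Ch. III §A.2, "Rearranging, we obtain Eckart's criterion: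
`ε² ≤ (⟨Φ|H|Φ⟩ − E₀)/(E₁ − E₀)` (10)" and "`a₀² ≥ 1 − [(⟨Φ|H|Φ⟩ − E₀)/(E₁ − E₀)]` (12)", pp. 92–93, there
for "`Ψ` assumed nondegenerate" with `X ⊥ Ψ` "expanded in the higher eigenfunctions of `H`" — read here inside
the symmetry subspace `K`, where `E₀, E₁` are the two lowest levels OF `Ĥ|_K` (Eckart 1930, Phys. Rev. 36, 878).
HONEST LIMITS: a singlet overlap row speaks about SINGLET ground states of the MODEL only; whether the sector
ground state is a singlet is a separate certificate (`Rows/SingletFromSectorGap`, `Rows/SingletVersusSector`)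
that an AF-coupled file will typically NOT admit at SDP width; informative only when `ρ < σ`; `w` degrades with
the lower-row slack `σ − ℓ`; nothing here produces a number, a gap leg or a claim node.
-/

noncomputable section

namespace Summit.Ventures.CertifiedQuantumChemistry

open Matrix Finset
open Literature.MathematicalPhysics.QuantumLattice Literature.MathematicalPhysics.QuantumChemistry
open Literature.MathematicalPhysics.QuantumLattice.EigenvalueContinuation
open Literature.MathematicalPhysics.QuantumLattice.SymmetryProjection (singletProj)
open scoped ComplexOrder

variable {k : ℕ}

/-! ## §1 Singlet-sector bookkeeping; singlet ground states

(`K = singletSector k n` is `Ĥ(F)`-invariant: `Model.hamiltonian_mulVec_mem_singletSector`, chem-type-09's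
`Rows/SingletGapCertificateCodimOne`, imported.) -/

/-- A singlet-sector vector lies in the joint sector `(N, S_z) = (2n, 0)`. [folklore] -/
theorem mem_szSector_zero_of_mem_singletSector {n : ℕ} {ψ : Fock (Orb (Fin k))}
    (h : ψ ∈ singletSector k n) : ψ ∈ szSector (n + n) 0 := by
  have h1 := ((mem_singletSector_iff ψ).1 h).1
  rwa [sub_self, zero_div] at h1

/-- A singlet-sector vector is annihilated by `Ŝ_+`. [folklore] -/
theorem spinPlus_mulVec_of_mem_singletSector {n : ℕ} {ψ : Fock (Orb (Fin k))}
    (h : ψ ∈ singletSector k n) : spinPlus *ᵥ ψ = 0 :=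
  ((mem_singletSector_iff ψ).1 h).2

/-- A singlet-sector vector is annihilated by `Ŝ²` (`Ŝ² = Ŝ_−Ŝ_+` on `S_z = 0`). Tasaki (2020) (A.3.6).
[folklore] -/
theorem spinSq_mulVec_of_mem_singletSector {n : ℕ} {ψ : Fock (Orb (Fin k))} (h : ψ ∈ singletSector k n) :
    spinSq *ᵥ ψ = 0 := by
  have hz : HubbardWave0.spinZ *ᵥ ψ = 0 := by
    rw [((mem_szSector_iff _ _ ψ).1 (mem_szSector_zero_of_mem_singletSector h)).2, Complex.ofReal_zero,
      zero_smul]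
  rw [spinSq_mulVec_of_spinZ_eq_zero hz, spinPlus_mulVec_of_mem_singletSector h, mulVec_zero]

/-- The singlet projector fixes every singlet-sector vector: `P_{S=0}ψ = ψ`. [folklore] -/
theorem singletProj_mulVec_of_mem_singletSector {n : ℕ} {ψ : Fock (Orb (Fin k))}
    (h : ψ ∈ singletSector k n) : singletProj *ᵥ ψ = ψ :=
  SymmetryProjection.singletProj_mulVec_of_spinSq_mulVec_eq_zero (spinSq_mulVec_of_mem_singletSector h)

/-- For `ψ` in the singlet sector and ANY `φ`: `⟨P_{S=0}φ, ψ⟩ = ⟨φ, ψ⟩` (`P` Hermitian, `Pψ = ψ`) — the overlap of a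
spin-contaminated trial with a singlet is carried by its singlet part alone. [folklore] -/
theorem star_singletProj_mulVec_dotProduct_of_mem {n : ℕ} {ψ : Fock (Orb (Fin k))}
    (h : ψ ∈ singletSector k n) (φ : Fock (Orb (Fin k))) :
    star (singletProj *ᵥ φ) ⬝ᵥ ψ = star φ ⬝ᵥ ψ := by
  rw [star_mulVec, SymmetryProjection.singletProj_conjTranspose, ← dotProduct_mulVec,
    singletProj_mulVec_of_mem_singletSector h]

/-- **`ψ` is a (variational) SINGLET GROUND STATE of the file `F` with `2n` electrons**: a nonzero vector of the
singlet sector `singletSector k n` (`(n, n)` determinant sector `∩ ker Ŝ_+`) whose energy expectation attains the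
singlet ground energy, `Re⟨ψ, Ĥ(F)ψ⟩ = E₀(Ĥ_F; N = 2n, S = 0)·⟨ψ, ψ⟩` (un-normalised; for symmetric `F` the same as
`Ĥ(F)ψ = E₀^{S=0}ψ` by `Model.IsSingletGroundState.hamiltonian_mulVec`; every vector of a degenerate singlet
ground eigenspace qualifies — the rows below quantify over ALL of them). Mirror of `Model.IsGroundState`
(`Rows/ObservableRows`). [cite: Thirring2002QMP, §4.3.38 Remark 2] -/
def Model.IsSingletGroundState (F : Model k) (n : ℕ) (ψ : Fock (Orb (Fin k))) : Prop :=
  ψ ∈ singletSector k n ∧ ψ ≠ 0 ∧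
    (star ψ ⬝ᵥ F.hamiltonian *ᵥ ψ).re = F.singletEnergy n * (star ψ ⬝ᵥ ψ).re

/-- **A variational singlet ground state of a symmetric file is an EIGENvector**:
`Ĥ(F)ψ = E₀^{S=0}·ψ` — equality case of Rayleigh–Ritz on the `Ĥ(F)`-invariant singlet sector
(`mulVec_eq_minEnergyOn_smul_of_rayleigh_le`, Horn–Johnson Thm 4.2.2 (b), p. 234).
[cite: HornJohnson2013, Thm 4.2.2, p. 234] -/
theorem Model.IsSingletGroundState.hamiltonian_mulVec {F : Model k} (hF : F.IsSymmetric) {n : ℕ}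
    {ψ : Fock (Orb (Fin k))} (h : F.IsSingletGroundState n ψ) :
    F.hamiltonian *ᵥ ψ = ((F.singletEnergy n : ℝ) : ℂ) • ψ := by
  have h3 := h.2.2
  unfold Model.singletEnergy at h3 ⊢
  exact mulVec_eq_minEnergyOn_smul_of_rayleigh_le (Model.hamiltonian_isHermitian hF) _
    (fun x hx => F.hamiltonian_mulVec_mem_singletSector hx) h.1 (le_of_eq h3)

/-- A singlet ground state forces the physical range `n ≤ k` (it is a nonzero `(n, n)`-sector vector).
[folklore] -/
theorem Model.IsSingletGroundState.range {F : Model k} {n : ℕ} {ψ : Fock (Orb (Fin k))}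
    (h : F.IsSingletGroundState n ψ) : n ≤ k :=
  (range_of_isInSector_ne_zero ((mem_singletSector_iff_isInSector ψ).1 h.1).1 h.2.1).1

/-- **Existence of a unit singlet ground state** on the physical range `n ≤ k` of a symmetric file (the minimum
of the Rayleigh quotient over the nonzero invariant subspace `K` is attained at an eigenvector; tree
`exists_unit_eigen_minEnergyOn`). [cite: HornJohnson2013, Thm 4.2.2, p. 234] -/
theorem Model.exists_isSingletGroundState {F : Model k} (hF : F.IsSymmetric) {n : ℕ} (hn : n ≤ k) :
    ∃ ψ : Fock (Orb (Fin k)), F.IsSingletGroundState n ψ ∧ star ψ ⬝ᵥ ψ = 1 := by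
  obtain ⟨ψ, hψK, hψ1, hHψ⟩ := exists_unit_eigen_minEnergyOn (Model.hamiltonian_isHermitian hF)
    (singletSector k n) (fun x hx => F.hamiltonian_mulVec_mem_singletSector hx)
    (singletSector_ne_bot hn)
  refine ⟨ψ, ⟨hψK, ?_, ?_⟩, hψ1⟩
  · rintro rfl
    rw [dotProduct_zero] at hψ1
    exact zero_ne_one hψ1
  · change F.hamiltonian *ᵥ ψ = ((F.singletEnergy n : ℝ) : ℂ) • ψ at hHψ
    rw [hHψ, dotProduct_smul, smul_eq_mul, Complex.re_ofReal_mul]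

/-! ## §2 The SINGLET OVERLAP row predicate -/

/-- **SINGLET OVERLAP LOWER row** `cos² ∠(φ, ψ₀^{S=0}) ≥ w`: `n ≤ k` and for EVERY singlet ground state `ψ` of the
pinned file `F` with `2n` electrons (`Model.IsSingletGroundState`), `w·⟨φ, φ⟩·⟨ψ, ψ⟩ ≤ |⟨φ, ψ⟩|²`. `φ` is an
explicit reference vector (a CI / MPS record read as a Fock vector, a CSF, or — via transfer — a determinant).
Eckart's `a₀²` (Goodisman 1973 Ch. III §A.2 (12), p. 93) read on the singlet sector. Nothing is asserted; rows
are proved by §3/§5. [cite: Goodisman1973, Ch. III §A.2 eqs. (10)–(12), pp. 92–93] -/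
def SingletOverlapLowerRow (F : Model k) (n : ℕ) (φ : Fock (Orb (Fin k))) (w : ℚ) : Prop :=
  n ≤ k ∧ ∀ ψ : Fock (Orb (Fin k)), F.IsSingletGroundState n ψ →
    ((w : ℚ) : ℝ) * ((star φ ⬝ᵥ φ).re * (star ψ ⬝ᵥ ψ).re) ≤ ‖star φ ⬝ᵥ ψ‖ ^ 2

namespace SingletOverlapLowerRow

variable {F : Model k} {n : ℕ} {φ : Fock (Orb (Fin k))} {w : ℚ}

/-- A singlet overlap row carries the physical range `n ≤ k`.
[cite: Goodisman1973, Ch. III §A.2 eqs. (10)–(12), pp. 92–93] -/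
theorem range (h : SingletOverlapLowerRow F n φ w) : n ≤ k := h.1

/-- Reading a singlet overlap row at a singlet ground state `ψ`: `w·⟨φ,φ⟩⟨ψ,ψ⟩ ≤ |⟨φ,ψ⟩|²`.
[cite: Goodisman1973, Ch. III §A.2 eqs. (10)–(12), pp. 92–93] -/
theorem le (h : SingletOverlapLowerRow F n φ w) {ψ : Fock (Orb (Fin k))} (hψ : F.IsSingletGroundState n ψ) :
    ((w : ℚ) : ℝ) * ((star φ ⬝ᵥ φ).re * (star ψ ⬝ᵥ ψ).re) ≤ ‖star φ ⬝ᵥ ψ‖ ^ 2 :=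
  h.2 ψ hψ

/-- Singlet overlap rows weaken downwards in the slot `w`.
[cite: Goodisman1973, Ch. III §A.2 eqs. (10)–(12), pp. 92–93] -/
theorem mono (h : SingletOverlapLowerRow F n φ w) {w' : ℚ} (hle : w' ≤ w) :
    SingletOverlapLowerRow F n φ w' :=
  ⟨h.1, fun ψ hψ => le_trans (mul_le_mul_of_nonneg_right (by exact_mod_cast hle)
    (mul_nonneg (re_star_dotProduct_self_nonneg φ) (re_star_dotProduct_self_nonneg ψ))) (h.2 ψ hψ)⟩

/-- No singlet overlap row exceeds `1` for `φ ≠ 0` on a symmetric file (Cauchy–Schwarz at a singlet ground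
state, which exists on the physical range). [folklore] -/
theorem le_one (hF : F.IsSymmetric) (h : SingletOverlapLowerRow F n φ w) (hφ : φ ≠ 0) : w ≤ 1 := by
  obtain ⟨ψ, hψ, -⟩ := Model.exists_isSingletGroundState hF h.1
  have hle := (h.2 ψ hψ).trans (norm_star_dotProduct_sq_le φ ψ)
  have hpos : 0 < (star φ ⬝ᵥ φ).re * (star ψ ⬝ᵥ ψ).re :=
    mul_pos (re_star_dotProduct_self_pos hφ) (re_star_dotProduct_self_pos hψ.2.1)
  have h1 : ((w : ℚ) : ℝ) ≤ 1 := le_of_mul_le_mul_right (by rwa [one_mul]) hpos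
  exact_mod_cast h1

/-- **DETERMINANT-WEIGHT reading** (`φ = |D⟩`): every singlet ground state `ψ` carries weight `|ψ(D)|² ≥ w·‖ψ‖²`
on `D` (such a row arises by TRANSFER from a singlet reference; a lone open-shell determinant is not itself in
`K`). [cite: Goodisman1973, Ch. III §A.2 eqs. (10)–(12), pp. 92–93] -/
theorem weight_le {D : Finset (Orb (Fin k))} (h : SingletOverlapLowerRow F n (Pi.single D 1) w)
    {ψ : Fock (Orb (Fin k))} (hψ : F.IsSingletGroundState n ψ) :
    ((w : ℚ) : ℝ) * (star ψ ⬝ᵥ ψ).re ≤ ‖ψ D‖ ^ 2 := by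
  have h1 := h.2 ψ hψ
  rwa [Model.star_single_dotProduct, Model.star_single_dotProduct, Pi.single_eq_same, Complex.one_re,
    one_mul] at h1

end SingletOverlapLowerRow

/-! ## §3 Eckart's criterion on the singlet sector from a codimension-one form bound (unit vectors, then rows) -/

/-- A unit vector is nonzero. [folklore] -/
private theorem ne_zero_of_unit {ψ : Fock (Orb (Fin k))} (h1 : star ψ ⬝ᵥ ψ = 1) : ψ ≠ 0 := by
  rintro rfl
  rw [dotProduct_zero] at h1
  exact zero_ne_one h1

/-- Scaling both arguments of a pairing by real scalars: `|⟨dφ, cψ⟩|² = d²c²|⟨φ, ψ⟩|²`. [folklore] -/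
private theorem norm_sq_star_smul_dotProduct_smul' (d c : ℝ) (φ ψ : Fock (Orb (Fin k))) :
    ‖star ((d : ℂ) • φ) ⬝ᵥ ((c : ℂ) • ψ)‖ ^ 2 = (d * d) * (c * c) * ‖star φ ⬝ᵥ ψ‖ ^ 2 := by
  rw [star_smul, smul_dotProduct, dotProduct_smul, smul_smul, smul_eq_mul, norm_mul, norm_mul,
    Complex.star_def, Complex.conj_ofReal, Complex.norm_real, Complex.norm_real, Real.norm_eq_abs,
    Real.norm_eq_abs, mul_pow, mul_pow, sq_abs, sq_abs]
  ring

/-- **ECKART ON `K` (unit vectors).** For a symmetric file `F`, a codimension-one gap leg on the singlet sector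
`SingletGapCertificateCodimOne F n σ` (`σ ≤ λ₂(Ĥ(F)|_K)` counting multiplicity, `K = singletSector k n`), a UNIT
`w ∈ K` with `Re⟨w, Ĥw⟩ ≤ ρ < σ`, and any `ℓ ≤ E₀^{S=0}`: every UNIT singlet ground eigenvector `ψ` satisfies
`(1 − |⟨w, ψ⟩|²)(σ − ℓ) ≤ ρ − ℓ`. (`E₀^{S=0} ≤ ρ < σ` by Rayleigh–Ritz on `K`; the certified form bound transfers to
`K ∩ ψ^⊥` by the two-dimensional Courant–Fischer step `TempleKato.gap_of_codimOne_certificate`; then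
`TempleKato.sin_sq_mul_gap_le`; replacing `E₀^{S=0}` by `ℓ` only loosens.) "`a₀² ≥ 1 − (⟨Φ|H|Φ⟩ − E₀)/(E₁ − E₀)`",
Goodisman (1973) Ch. III §A.2 (12), p. 93, inside the symmetry subspace `K`.
[cite: Goodisman1973, Ch. III §A.2 eqs. (10)–(12), pp. 92–93] -/
theorem singlet_one_sub_overlap_sq_mul_le {F : Model k} (hF : F.IsSymmetric) {n : ℕ} {σ : ℚ}
    (hG : SingletGapCertificateCodimOne F n σ)
    {w : Fock (Orb (Fin k))} (hwK : w ∈ singletSector k n) (hw1 : star w ⬝ᵥ w = 1) {ρ : ℝ}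
    (hρ : (star w ⬝ᵥ F.hamiltonian *ᵥ w).re ≤ ρ) (hρσ : ρ < ((σ : ℚ) : ℝ)) {ℓ : ℝ}
    (hℓ : ℓ ≤ F.singletEnergy n)
    {ψ : Fock (Orb (Fin k))} (hψK : ψ ∈ singletSector k n) (hψ1 : star ψ ⬝ᵥ ψ = 1)
    (hHψ : F.hamiltonian *ᵥ ψ = ((F.singletEnergy n : ℝ) : ℂ) • ψ) :
    (1 - ‖star w ⬝ᵥ ψ‖ ^ 2) * (((σ : ℚ) : ℝ) - ℓ) ≤ ρ - ℓ := by
  obtain ⟨W, u, hW, hWK⟩ := hG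
  have hH : F.hamiltonian.IsHermitian := Model.hamiltonian_isHermitian hF
  have hE0ρ : F.singletEnergy n ≤ ρ :=
    minEnergyOn_le_of_rayleigh hH (singletSector k n) hwK (ne_zero_of_unit hw1)
      (by rw [hw1, Complex.one_re, mul_one]; exact hρ)
  have hE0σ : F.singletEnergy n < ((σ : ℚ) : ℝ) := hE0ρ.trans_lt hρσ
  have hgapψ : ∀ z ∈ singletSector k n, star ψ ⬝ᵥ z = 0 →
      ((σ : ℚ) : ℝ) * (star z ⬝ᵥ z).re ≤ (star z ⬝ᵥ F.hamiltonian *ᵥ z).re :=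
    fun z hzK hz => TempleKato.gap_of_codimOne_certificate hH.eq hW hWK hψK hψ1 hHψ hE0σ hzK hz
  have key := TempleKato.sin_sq_mul_gap_le hH.eq hψ1 hHψ hψK hgapψ hwK hw1
  have hsym : ‖star w ⬝ᵥ ψ‖ = ‖star ψ ⬝ᵥ w‖ := by rw [star_dotProduct, norm_star]
  rw [hsym]
  have hx : 0 ≤ ‖star ψ ⬝ᵥ w‖ ^ 2 := by positivity
  nlinarith [mul_nonneg hx (sub_nonneg.2 hℓ)]

/-- **SINGLET OVERLAP ROW FROM A GAP LEG ON `K` (Eckart's criterion on the singlet sector, soundness).** For a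
symmetric file `F`, `n ≤ k`: a codimension-one gap leg `SingletGapCertificateCodimOne F n σ` (`σ ≤ λ₂(Ĥ(F)|_K)`
counting multiplicity), an explicit NONZERO reference `φ ∈ singletSector k n` with `Re⟨φ, Ĥ(F)φ⟩ ≤ ρ·⟨φ, φ⟩`, a
bound `ℓ ≤ E₀^{S=0}` (cast of a rational), `ρ < σ`, and a rational slot with `w·(σ − ℓ) ≤ σ − ρ` give
`SingletOverlapLowerRow F n φ w`: every singlet ground state has `cos² ∠(φ, ψ) ≥ w`.
"`a₀² ≥ 1 − [(⟨Φ|H|Φ⟩ − E₀)/(E₁ − E₀)]`" (12) with `E₁ ≥ σ`, `E₀ ≥ ℓ`, Goodisman (1973) Ch. III §A.2, pp. 92–93.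
[cite: Goodisman1973, Ch. III §A.2 eqs. (10)–(12), pp. 92–93] -/
theorem singletOverlapLowerRow_of_singletGapCertificateCodimOne_of_le {F : Model k} (hF : F.IsSymmetric)
    {n : ℕ} (hn : n ≤ k) {σ : ℚ} (hG : SingletGapCertificateCodimOne F n σ)
    {φ : Fock (Orb (Fin k))} (hφK : φ ∈ singletSector k n) (hφ0 : φ ≠ 0)
    {ρ : ℚ} (hρ : (star φ ⬝ᵥ F.hamiltonian *ᵥ φ).re ≤ ((ρ : ℚ) : ℝ) * (star φ ⬝ᵥ φ).re)
    {ℓ : ℚ} (hℓ : ((ℓ : ℚ) : ℝ) ≤ F.singletEnergy n) (hρσ : ρ < σ) {w : ℚ} (hw : w * (σ - ℓ) ≤ σ - ρ) :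
    SingletOverlapLowerRow F n φ w := by
  refine ⟨hn, fun ψ hψ => ?_⟩
  obtain ⟨d, hd, hdd, hd1⟩ := exists_normalize hφ0
  obtain ⟨c, hc, hcc, hc1⟩ := exists_normalize hψ.2.1
  have hHψ := hψ.hamiltonian_mulVec hF
  have hHψ₁ : F.hamiltonian *ᵥ ((c : ℂ) • ψ) = ((F.singletEnergy n : ℝ) : ℂ) • ((c : ℂ) • ψ) := by
    rw [mulVec_smul, hHψ, smul_comm]
  have hρ₁ : (star ((d : ℂ) • φ) ⬝ᵥ F.hamiltonian *ᵥ ((d : ℂ) • φ)).re ≤ ((ρ : ℚ) : ℝ) := by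
    rw [re_star_smul_dotProduct_mulVec_smul]
    calc d * d * (star φ ⬝ᵥ F.hamiltonian *ᵥ φ).re
        ≤ d * d * (((ρ : ℚ) : ℝ) * (star φ ⬝ᵥ φ).re) := mul_le_mul_of_nonneg_left hρ (mul_self_nonneg d)
      _ = ((ρ : ℚ) : ℝ) := by rw [← mul_assoc, mul_comm (d * d), mul_assoc, hdd, mul_one]
  have key := singlet_one_sub_overlap_sq_mul_le hF hG (Submodule.smul_mem _ _ hφK) hd1 hρ₁
    (by exact_mod_cast hρσ) hℓ (Submodule.smul_mem _ _ hψ.1) hc1 hHψ₁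
  rw [norm_sq_star_smul_dotProduct_smul'] at key
  have hw' : ((w : ℚ) : ℝ) * (((σ : ℚ) : ℝ) - ℓ) ≤ ((σ : ℚ) : ℝ) - ρ := by exact_mod_cast hw
  have hE0ρ : F.singletEnergy n ≤ ((ρ : ℚ) : ℝ) :=
    minEnergyOn_le_of_rayleigh (Model.hamiltonian_isHermitian hF) (singletSector k n) hφK hφ0 hρ
  have hσℓ : 0 < ((σ : ℚ) : ℝ) - ℓ := by
    have : ((ρ : ℚ) : ℝ) < σ := by exact_mod_cast hρσ
    linarith
  have h1 : ((w : ℚ) : ℝ) * (((σ : ℚ) : ℝ) - ℓ) ≤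
      (d * d) * (c * c) * ‖star φ ⬝ᵥ ψ‖ ^ 2 * (((σ : ℚ) : ℝ) - ℓ) := by linarith
  have h2 : ((w : ℚ) : ℝ) ≤ (d * d) * (c * c) * ‖star φ ⬝ᵥ ψ‖ ^ 2 := le_of_mul_le_mul_right h1 hσℓ
  have hnn : 0 ≤ (star φ ⬝ᵥ φ).re * (star ψ ⬝ᵥ ψ).re :=
    mul_nonneg (re_star_dotProduct_self_nonneg φ) (re_star_dotProduct_self_nonneg ψ)
  calc ((w : ℚ) : ℝ) * ((star φ ⬝ᵥ φ).re * (star ψ ⬝ᵥ ψ).re)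
      ≤ (d * d) * (c * c) * ‖star φ ⬝ᵥ ψ‖ ^ 2 * ((star φ ⬝ᵥ φ).re * (star ψ ⬝ᵥ ψ).re) :=
        mul_le_mul_of_nonneg_right h2 hnn
    _ = (d * d * (star φ ⬝ᵥ φ).re) * (c * c * (star ψ ⬝ᵥ ψ).re) * ‖star φ ⬝ᵥ ψ‖ ^ 2 := by ring
    _ = ‖star φ ⬝ᵥ ψ‖ ^ 2 := by rw [hdd, hcc, one_mul, one_mul]

/-- **SINGLET OVERLAP ROW, `ℓ` from an ordinary SECTOR lower row** (`LowerRow F n n ℓ`: `ℓ ≤ E₀(n, n) ≤ E₀^{S=0}`,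
`Model.energy_le_singletEnergy`) — the pairing the cell's files deliver (DQG / spin-flip-quotient legs are sector
rows). [cite: Goodisman1973, Ch. III §A.2 eqs. (10)–(12), pp. 92–93] -/
theorem singletOverlapLowerRow_of_singletGapCertificateCodimOne {F : Model k} (hF : F.IsSymmetric) {n : ℕ}
    {σ : ℚ} (hG : SingletGapCertificateCodimOne F n σ)
    {φ : Fock (Orb (Fin k))} (hφK : φ ∈ singletSector k n) (hφ0 : φ ≠ 0)
    {ρ : ℚ} (hρ : (star φ ⬝ᵥ F.hamiltonian *ᵥ φ).re ≤ ((ρ : ℚ) : ℝ) * (star φ ⬝ᵥ φ).re)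
    {ℓ : ℚ} (hL : LowerRow F n n ℓ) (hρσ : ρ < σ) {w : ℚ} (hw : w * (σ - ℓ) ≤ σ - ρ) :
    SingletOverlapLowerRow F n φ w :=
  singletOverlapLowerRow_of_singletGapCertificateCodimOne_of_le hF hL.range.1 hG hφK hφ0 hρ
    (hL.le.trans (Model.energy_le_singletEnergy hF hL.range.1)) hρσ hw

/-- **SINGLET OVERLAP ROW, `ℓ` from a SINGLET lower row** (`SingletLowerRow F n ℓ`, e.g. a certificate with the
`Ŝ_−Ŝ_+` ideal row). [cite: Goodisman1973, Ch. III §A.2 eqs. (10)–(12), pp. 92–93] -/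
theorem singletOverlapLowerRow_of_singletGapCertificateCodimOne_singletLowerRow {F : Model k}
    (hF : F.IsSymmetric) {n : ℕ} {σ : ℚ} (hG : SingletGapCertificateCodimOne F n σ)
    {φ : Fock (Orb (Fin k))} (hφK : φ ∈ singletSector k n) (hφ0 : φ ≠ 0)
    {ρ : ℚ} (hρ : (star φ ⬝ᵥ F.hamiltonian *ᵥ φ).re ≤ ((ρ : ℚ) : ℝ) * (star φ ⬝ᵥ φ).re)
    {ℓ : ℚ} (hL : SingletLowerRow F n ℓ) (hρσ : ρ < σ) {w : ℚ} (hw : w * (σ - ℓ) ≤ σ - ρ) :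
    SingletOverlapLowerRow F n φ w :=
  singletOverlapLowerRow_of_singletGapCertificateCodimOne_of_le hF hL.range hG hφK hφ0 hρ hL.le hρσ hw

/-- **PRODUCER-AGNOSTIC form (HYPOTHESES-M1OS (G) literally as the hypothesis).** An explicit vector `v` with the
bare form bound «`∀ x ∈ singletSector k n, ⟨v, x⟩ = 0 → σ‖x‖² ≤ Re⟨x, Ĥ(F)x⟩`» (chem-type-09's
`singletGapCertificateCodimOne_of_forall_orthogonal'` turns it into the gap leg), a nonzero reference `φ ∈ K` with
`Re⟨φ, Ĥφ⟩ ≤ ρ‖φ‖²`, a sector lower row `ℓ`, `ρ < σ`, `w(σ − ℓ) ≤ σ − ρ` ⇒ `SingletOverlapLowerRow F n φ w`.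
[cite: Goodisman1973, Ch. III §A.2 eqs. (10)–(12), pp. 92–93] -/
theorem singletOverlapLowerRow_of_forall_orthogonal {F : Model k} (hF : F.IsSymmetric) {n : ℕ} {σ : ℚ}
    (v : Fock (Orb (Fin k)))
    (hgap : ∀ x ∈ singletSector k n, star v ⬝ᵥ x = 0 →
      ((σ : ℚ) : ℝ) * (star x ⬝ᵥ x).re ≤ (star x ⬝ᵥ F.hamiltonian *ᵥ x).re)
    {φ : Fock (Orb (Fin k))} (hφK : φ ∈ singletSector k n) (hφ0 : φ ≠ 0)
    {ρ : ℚ} (hρ : (star φ ⬝ᵥ F.hamiltonian *ᵥ φ).re ≤ ((ρ : ℚ) : ℝ) * (star φ ⬝ᵥ φ).re)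
    {ℓ : ℚ} (hL : LowerRow F n n ℓ) (hρσ : ρ < σ) {w : ℚ} (hw : w * (σ - ℓ) ≤ σ - ρ) :
    SingletOverlapLowerRow F n φ w :=
  singletOverlapLowerRow_of_singletGapCertificateCodimOne hF
    (singletGapCertificateCodimOne_of_forall_orthogonal' F v hgap) hφK hφ0 hρ hL hρσ hw

/-! ## §4 Certified simplicity of the singlet ground level -/

/-- **CERTIFIED NON-DEGENERACY of the singlet ground level (energy form).** A codimension-one gap leg on the
singlet sector `SingletGapCertificateCodimOne F n σ` together with `E₀^{S=0} < σ` makes the lowest level of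
`Ĥ(F)|_K` SIMPLE: any two singlet ground states are parallel, `ψ' = c•ψ` (the tree's `TempleKato.eq_smul_of_eigen`
on `K`). This is the «`Ψ` is assumed nondegenerate» of Goodisman (1973) p. 92, certified rather than assumed —
what every Temple-on-`K` reading and every «the open-shell singlet» sentence presupposes. Horn–Johnson Thm 4.2.6
(Courant–Fischer step), p. 235. [cite: HornJohnson2013, Thm 4.2.6, p. 235] -/
theorem singletGroundState_eq_smul_of_energy_lt_gap {F : Model k} (hF : F.IsSymmetric) {n : ℕ} {σ : ℚ}
    (hG : SingletGapCertificateCodimOne F n σ) (hE0σ : F.singletEnergy n < ((σ : ℚ) : ℝ))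
    {ψ ψ' : Fock (Orb (Fin k))} (hψ : F.IsSingletGroundState n ψ) (hψ' : F.IsSingletGroundState n ψ') :
    ∃ c : ℂ, ψ' = c • ψ := by
  obtain ⟨W, u, hW, hWK⟩ := hG
  have hH : F.hamiltonian.IsHermitian := Model.hamiltonian_isHermitian hF
  obtain ⟨c, hc, hcc, hc1⟩ := exists_normalize hψ.2.1
  have hψ₁K : ((c : ℂ) • ψ) ∈ singletSector k n := Submodule.smul_mem _ _ hψ.1
  have hHψ := hψ.hamiltonian_mulVec hF
  have hHψ₁ : F.hamiltonian *ᵥ ((c : ℂ) • ψ) = ((F.singletEnergy n : ℝ) : ℂ) • ((c : ℂ) • ψ) := by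
    rw [mulVec_smul, hHψ, smul_comm]
  have hgapψ : ∀ z ∈ singletSector k n, star ((c : ℂ) • ψ) ⬝ᵥ z = 0 →
      ((σ : ℚ) : ℝ) * (star z ⬝ᵥ z).re ≤ (star z ⬝ᵥ F.hamiltonian *ᵥ z).re :=
    fun z hzK hz => TempleKato.gap_of_codimOne_certificate hH.eq hW hWK hψ₁K hc1 hHψ₁ hE0σ hzK hz
  have h := TempleKato.eq_smul_of_eigen hc1 hHψ₁ hψ₁K hE0σ hgapψ hψ'.1 (hψ'.hamiltonian_mulVec hF)
  exact ⟨(star ((c : ℂ) • ψ) ⬝ᵥ ψ') * (c : ℂ), by rw [← smul_smul]; exact h⟩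

/-- **CERTIFIED NON-DEGENERACY from a gap leg on `K` and a singlet UPPER row**: `SingletUpperRow F n hi` with
`hi < σ` (`E₀^{S=0} ≤ hi < σ ≤ λ₂(Ĥ|_K)`) ⇒ any two singlet ground states are parallel.
[cite: HornJohnson2013, Thm 4.2.6, p. 235] -/
theorem singletGroundState_eq_smul_of_singletUpperRow_lt {F : Model k} (hF : F.IsSymmetric) {n : ℕ}
    {σ hi : ℚ} (hG : SingletGapCertificateCodimOne F n σ) (hU : SingletUpperRow F n hi) (hlt : hi < σ)
    {ψ ψ' : Fock (Orb (Fin k))} (hψ : F.IsSingletGroundState n ψ) (hψ' : F.IsSingletGroundState n ψ') :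
    ∃ c : ℂ, ψ' = c • ψ :=
  singletGroundState_eq_smul_of_energy_lt_gap hF hG (hU.le.trans_lt (by exact_mod_cast hlt)) hψ hψ'

/-- **CERTIFIED NON-DEGENERACY from a gap leg on `K` and ANY singlet reference below it**: a nonzero
`φ ∈ singletSector k n` with `Re⟨φ, Ĥφ⟩ ≤ ρ‖φ‖²`, `ρ < σ` (the same data as the overlap row) ⇒ simple singlet
ground level. [cite: HornJohnson2013, Thm 4.2.6, p. 235] -/
theorem singletGroundState_eq_smul_of_rayleigh_lt {F : Model k} (hF : F.IsSymmetric) {n : ℕ} {σ ρ : ℚ}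
    (hG : SingletGapCertificateCodimOne F n σ)
    {φ : Fock (Orb (Fin k))} (hφK : φ ∈ singletSector k n) (hφ0 : φ ≠ 0)
    (hρ : (star φ ⬝ᵥ F.hamiltonian *ᵥ φ).re ≤ ((ρ : ℚ) : ℝ) * (star φ ⬝ᵥ φ).re) (hρσ : ρ < σ)
    {ψ ψ' : Fock (Orb (Fin k))} (hψ : F.IsSingletGroundState n ψ) (hψ' : F.IsSingletGroundState n ψ') :
    ∃ c : ℂ, ψ' = c • ψ := by
  have hE0ρ : F.singletEnergy n ≤ ((ρ : ℚ) : ℝ) :=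
    minEnergyOn_le_of_rayleigh (Model.hamiltonian_isHermitian hF) (singletSector k n) hφK hφ0 hρ
  exact singletGroundState_eq_smul_of_energy_lt_gap hF hG (hE0ρ.trans_lt (by exact_mod_cast hρσ)) hψ hψ'


end Summit.Ventures.CertifiedQuantumChemistry

end
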